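import Mathlib
import Summits.Ventures.PercRepro2.Defs
import Summits.Ventures.PercRepro2.Harris
import Summits.Ventures.PercRepro2.Graph
import Summits.Ventures.PercRepro2.Induced
import Summits.Ventures.PercRepro2.VdBKahn
import Summits.Ventures.PercRepro2.NestIID

/-!
# The mixed nested core-forbidden sum and its three-nest identity
(blind cell PercRepro2, mine-1 g10; proofs/MINE1-SAMEKERNEL-FRAME.md §9)

Two independent clusters `C, C'` of `s`, copy 1 avoiding `X`, copy 2 avoiding `Y`, and a vertex `u`
forbidden from the core `C ∩ C'`:

`mixedCoreForbidIID X Y u = Σ_{ω,ω'} w w' 1_{R_X}(ω) 1_{R_Y}(ω') (1 − 1[u∈C] 1[u∈C']) σ_x σ_y`.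

Since `1 − U U' = (1 − U) + (1 − U') − (1 − U)(1 − U')` pointwise, it equals
`nestIID (X ∪ u) Y + nestIID X (Y ∪ u) − nestIID (X ∪ u) (Y ∪ u)` (`mixedCoreForbidIID_eq_nest`),
so the row `MixedCoreForbidRow` (for `X ⊆ Y`, `u ∉ Y`) reads: the two one-sided avoidances of `u`
dominate the double one — `nestIID (X∪u) Y + nestIID X (Y∪u) ≥ nestIID (X∪u) (Y∪u)`, where the
first summand has INCOMPARABLE avoided sets (it may be negative). Theorem 3 of the proofs file
proves the row with an explicit vdBK certificate (paper); its diagonal `X = Y` is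
`CoreForbidIID.coreForbidIID_nonneg` (landed). This file only fixes the statement and the identity.
-/

namespace Summit.Ventures.PercRepro2

section MixedCoreForbid

variable {V : Type*} {E : Type*} [Fintype E] [DecidableEq E] [Fintype V] [DecidableEq V]
  {R : Type*} [CommRing R] [LinearOrder R] [IsStrictOrderedRing R]

/-- The two-copy sum with copy 1 avoiding `X`, copy 2 avoiding `Y`, and `u` forbidden from the core. -/
noncomputable def mixedCoreForbidIID (p : E → R) (ends : E → Sym2 V) (s x y : V) (X Y : Finset V)
    (u : V) : R :=
  ∑ ω : Config E, ∑ ω' : Config E,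
    weight p ω * weight p ω' * avoidInd ends s X ω * avoidInd ends s Y ω' *
      (1 - connInd ends s u ω * connInd ends s u ω') *
      ((connInd ends s x ω - connInd ends s x ω') * (connInd ends s y ω - connInd ends s y ω'))

variable (p : E → R) (ends : E → Sym2 V) (s x y : V)

omit [DecidableEq E] [LinearOrder R] [IsStrictOrderedRing R] in
/-- `1_{R_{X ∪ t}} = 1_{R_X} · (1 − 1[s ↔ t])` (as in `DeltaMonoNest.avoidInd_insert`). -/
lemma avoidInd_insert_mixed (X : Finset V) (t : V) (ω : Config E) :
    (avoidInd ends s (insert t X) ω : R) = avoidInd ends s X ω * (1 - connInd ends s t ω) := by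
  classical
  simp only [avoidInd, connInd, avoidAll, Set.mem_setOf_eq, Finset.mem_insert, forall_eq_or_imp]
  by_cases hX : ∀ v ∈ X, ¬ Conn ends ω s v
  · by_cases ht : Conn ends ω s t
    · simp [ht]
    · simp [ht]
  · by_cases ht : Conn ends ω s t
    · simp [hX, ht]
    · simp [hX, ht]

omit [LinearOrder R] [IsStrictOrderedRing R] in
/-- **The three-nest identity**: forbidding `u` from the core is "avoid `u` in copy 1, plus avoid
`u` in copy 2, minus avoid `u` in both". -/
theorem mixedCoreForbidIID_eq_nest (X Y : Finset V) (u : V) :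
    mixedCoreForbidIID p ends s x y X Y u =
      nestIID p ends s x y (insert u X) Y + nestIID p ends s x y X (insert u Y) -
        nestIID p ends s x y (insert u X) (insert u Y) := by
  unfold mixedCoreForbidIID nestIID
  simp only [← Finset.sum_add_distrib, ← Finset.sum_sub_distrib]
  refine Finset.sum_congr rfl fun ω _ => Finset.sum_congr rfl fun ω' _ => ?_
  rw [avoidInd_insert_mixed (R := R), avoidInd_insert_mixed (R := R)]
  ring

/-- **Row (MIXED core-forbidden)** — Theorem 3 of proofs/MINE1-SAMEKERNEL-FRAME.md §9 (paper):
for `X ⊆ Y` and `u ∉ Y ∪ {x, y}`, `x ≠ y`, the mixed sum is nonnegative. -/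
def MixedCoreForbidRow : Prop := ∀ (X Y : Finset V) (u : V), X ⊆ Y → u ∉ Y → u ≠ x → u ≠ y →
  x ≠ y → 0 ≤ mixedCoreForbidIID p ends s x y X Y u

end MixedCoreForbid

end Summit.Ventures.PercRepro2
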